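import Literature.MathematicalPhysics.QuantumFieldTheory.Balaban1983to89.B8LeafModelZd3SourceReality

/-!
# `Balaban1983to89.B8LeafModelZd3SourceBounded` — the SECOND hole of the source space of NODE 00's carrier `B8LeafModelZd3.zdGF3`:
# on the infinite `ℤᵈ` carriers `fNorm := B8ScaledSupNorm.msup … (−2)` is a real `iSup` with junk value `0` on UNBOUNDED families, so an
# unbounded **Hermitian** source `f ∈ R(U₀)` is admitted with «`|f|₍₋₂₎ = 0 < γ(α₀+α₁)`» — and for such a source [Balaban1985RegularSpaces]
# THEOREM 8 in its surviving form FAILS at the depth-one all-`ℤᵈ` member.  Sequel of `B8LeafModelZd3SourceReality` (the «Lie algebra valued»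
# hole): it shows that re-typing `Src ∕ InR` with a Hermitian clause ALONE would leave `Thm8SurvivingAt` false; the repair must ALSO type the
# finiteness of print's norm `sup_j sup_{Ω_j}` (automatic on his finite torus)

statement-level skeleton of published theorems with citation tags; proofs where landed; nothing here is a claim about the
Yang–Mills mass gap

T. Bałaban, *Spaces of regular gauge field configurations on a lattice and gauge fixing conditions*, Commun. Math. Phys. **99** (1985)
75–102 `[Balaban1985RegularSpaces]` ("B8"; journal page = PDF page + 74): Thm 8 (1.146) p. 101 («f … a Lie algebra valued function defined on
Ω₀ … |f|₍₋₂₎ < γ(α₀ + α₁)»), p. 86 (after (1.55): «|A|_(α) = sup_j sup_{Ω_j} (Lʲη)^{−α}|A|» — a maximum over a FINITE torus), (1.62) p. 87,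
(1.33)–(1.35) p. 82, p. 77 («we admit Ω_j = T_η»); [4] = T. Bałaban, *Propagators for lattice gauge theories in a background field*, CMP **99**
(1985) 389–434, (3.19)–(3.25) pp. 393–394.

## WHY THIS FILE (cell `pub-ymgap`, HUMAN RULING D-0062; R134 seat `pub-ymgap-dag-n05-c` g5, DAG node N05 = [B8]; a LOCATED NEGATIVE, count-neutral)

`B8LeafModelZd3SourceReality` (p501857) certified that `Thm8SurvivingAt γ B₁ B₂` is FALSE at the record families because `zdGF3`'s `Src ∕ InR`
admit non-Hermitian sources, and proposed the one-field repair `InR U₀ f := InR138 … f ∧ (∀ x, IsSelfAdjoint (f x)) ∧ B8ScaledSupNorm.Bdd …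
(−2) … f`.  THIS FILE justifies the THIRD conjunct: with the Hermitian clause alone the sentence is still false, through a different mechanism.
On `Ω₀ = ℤᵈ` take the dipole TRAIN `λ_∞ = Σ_{n≥1} n·(δ_{aₙ} − δ_{aₙ+e₀})·1`, `aₙ = 4n·e₁` (Hermitian; zero sum on every `L`-block since `aₙ` and
`aₙ + e₀` share a block, so `f := Δ^η_1λ_∞ ∈ R(1)` at the depth-one LamTop member, `B8Eq138LandauZd.InR138`).  The weighted family
`(Lʲη)²‖f‖` is UNBOUNDED (`‖f(aₙ)‖ = n·(2d+1)η⁻²`), so `msup = ⨆ = 0` (`Real.iSup_of_not_bddAbove`) and the premiss `fNorm f < γ(α₀+α₁)`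
holds.  Theorem 8's conclusion would give `u` with (1.62) — `‖A′‖ ≤ B₁(α₀+α₁)η⁻¹` on all bonds, hence `‖Δ^η_1D^{η*}_1A′‖ ≤ M₂` uniformly — and
(1.146) `Δ(D^{η*}_1A′ − f) = Q′(1)ᵀμ`; evaluating at `aₙ` and `aₙ + e₀` (same `Lʲ`-block, the `μ`-terms cancel) leaves `‖n·κ·1‖ ≤ 2M₂` with the
dipole constant `κ > 0` of `flatLap_dipole_pos` — false for `n > 2M₂/κ`.

## WHAT IS PROVED (kernel, 0 sorry, theorems only; axioms `propext` ∕ `Classical.choice` ∕ `Quot.sound`)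

* §1 the flat scalar stencil `G` (letter with law): `flatLap_dipole_at_zero` (`(Gc)(0) = (2d+1)rη⁻²`), one- and two-level LOCALITY
  (`flatLap_congr_at`, `flatLap_flatLap_congr_at`), translation covariance (`flatLap_translate`), homogeneity (`flatLap_constMul`).
* §2 the dipole train as a letter `g` with its law: `train_add_e_apply`, ★ `train_blockSum_zero` (zero sum on every `L`-block, by the
  involution swapping the `e₀`-coordinates `0 ↔ 1`, `Finset.sum_involution`), `train_near_dipole` (in the frame of `aₙ` the train IS `n·c` on
  the sites with `|y₁| ≤ 3`), `abs_step_apply_le`, `train_flatLap_at` (`(Gg)(aₙ) = n·(Gc)(0)`), `train_flatLap_flatLap_at`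
  (`(G(Gg))(aₙ + x) = n·(G(Gc))(x)`, `x ∈ {0, e₀}`).
* §3 `QT_flat_lamTop_eq_of_blockMap`, `norm_covDivB_flat_le`, ★★ **`thm8Surviving_fails_hermitian_unbounded_source`**: at every `zdGF3`
  member with `Ω_j = ℤᵈ`, `Λs m j = {j = m}`, `k = 1` (`d ≥ 2`, `L ≥ 2`; every `β, len, γ > 0, B₁`) and every threshold `c₁ > 0` there are
  data `α₀ = α₁ = c₁/2`, `U₀ = U′ = 1` satisfying (1.33)∕(1.34)∕(1.35) and a HERMITIAN `f` with `InR U₀ f`, `fNorm f < γ(α₀ + α₁)` for which NO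
  `u : GT` satisfies `C162 B₁ (α₀+α₁) U₀ (act U′ u) ∧ LandauF U₀ f (act U′ u)` — i.e. the body of `Thm8SurvivingAt` fails on a Hermitian
  source; ★ `…_famB8OfRecordSubB` — the same at a member of the four-law sub-family of record `B8IdxB8LawsB.famB8OfRecordSubB θ β len`
  (`θ.D ≥ 2`).

## READING ∕ HONEST SCOPE

A statement about the TYPING of the carrier of record (the real-`iSup` reading of print's finite-torus supremum admits unbounded sources with
norm `0`), proved by elementary lattice algebra at the flat datum; nothing of Bałaban's theorem or of [4] is used or refuted.  Together with
`B8LeafModelZd3SourceReality`: the repair of `Src ∕ InR` must carry BOTH «Lie algebra valued» AND «finite `|·|₍₋₂₎`».  Count-neutral; N05 NOT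
discharged; `T_η ↦ ℤᵈ`, `G = U(𝔸)`; one finite `T⁴` programme at fixed `ε`, Bałaban as printed — nothing continuum ∕ ℝ⁴ ∕ OS ∕ mass-gap ∕
Clay.  No `sorry`, no `def`, no `instance`, no `notation`.  Unit `pub-ymgap-dag-n05-c` (g5), 2026-08-27.

[cite: Balaban1985RegularSpaces, Thm 8 (1.146) p.101, p.86 (definition after (1.55)), (1.62) p.87, (1.33)–(1.35) p.82, (1.29) p.81, p.77;
Balaban1985BackgroundPropagators, (3.19) p.393, (3.23)–(3.25) p.394]
-/

noncomputable section

open NormedSpace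

namespace Literature.MathematicalPhysics.QuantumFieldTheory.Balaban1983to89.B8LeafModelZd3SourceBounded

open B7Prop1Explicit (e e_apply)
open B7Eq78Linearization (conjR conjR_apply QprimeIter zdBlocking)
open B8Ineq132 (covDeriv covDerivFwd InAk BondTouches)
open B7Prop2Explicit (unitaryUnits avgIter)
open B8Lemma1NonAbelian (mulCfg)
open B8Eq119TwistedAxial (bgT bgT_one Restr129 InAx inAx_self)
open B8Eq138LandauZd (covDivB covLap qprimeT1 QprimeT QT InR138 IsLandau146W IsLandau146 logCfg)
open B8Eq191FlatStencils (covLap_flat_apply covDeriv_flat_apply QT_flat_apply QprimeIter_flat_eq_sum_of_supp)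
open Literature.MathematicalPhysics.QuantumLattice (blockMap blockSites mem_blockSites_iff)
open B8LeafModelZd (ZdIdx)
open B8LeafModelZd3 (zdGF3)
open B8LeafModelZd3SourceReality (covLap_flat_realSmul_one covLap_flat_sub norm_covLap_flat_le flatLap_dipole_pos)

-- `Site` alone could resolve to the torus sites of `Setup.lean`; re-export the `ℤ^d` sites of `B7Prop1Explicit`.
export B7Prop1Explicit (Site)

variable {d : ℕ}

/-! ## §1 Locality, translation covariance and homogeneity of the flat stencil; the dipole value at the origin -/

section FlatLocality

open Function (support)

variable {η : ℝ} {G : (Site d → ℝ) → Site d → ℝ}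

/-- **`(Gc)(0) = (2d+1)·r·η⁻²`** for the dipole `c = r(δ₀ − δ_{e_μ₀})` (the computation inside `B8LeafModelZd3SourceReality.flatLap_dipole_pos`,
exported). [cite: Balaban1985BackgroundPropagators, (3.23) p.394] -/
theorem flatLap_dipole_at_zero [DecidableEq (Site d)]
    (hG : ∀ c x, G c x = (η ^ 2)⁻¹ * ∑ μ : Fin d, (2 * c x - c (x + e μ) - c (x - e μ)))
    (r : ℝ) (μ₀ : Fin d) {c : Site d → ℝ} (hc : c = fun x => if x = 0 then r else if x = e μ₀ then -r else 0) :
    G c 0 = (η ^ 2)⁻¹ * ((2 * d + 1) * r) := by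
  have heμ : ∀ μ : Fin d, e μ μ = 1 := fun μ => by rw [e_apply, if_pos rfl]
  have he0 : ∀ μ : Fin d, e μ ≠ (0 : Site d) := fun μ h => by
    have h1 := congrArg (fun x : Site d => x μ) h
    rw [heμ, Pi.zero_apply] at h1
    exact one_ne_zero h1
  have hee : ∀ μ : Fin d, e μ = e μ₀ ↔ μ = μ₀ := fun μ => by
    refine ⟨fun h => ?_, fun h => by rw [h]⟩
    have h1 := congrArg (fun x : Site d => x μ) h
    rw [heμ, e_apply] at h1
    by_contra hμ
    rw [if_neg hμ] at h1
    exact one_ne_zero h1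
  have hne' : ∀ μ : Fin d, -e μ ≠ e μ₀ := fun μ h => by
    have h1 := congrArg (fun x : Site d => x μ) h
    rw [Pi.neg_apply, heμ, e_apply] at h1
    by_cases hμ : μ = μ₀
    · rw [if_pos hμ] at h1; linarith
    · rw [if_neg hμ] at h1; linarith
  have hne0' : ∀ μ : Fin d, -e μ ≠ (0 : Site d) := fun μ h => he0 μ (neg_eq_zero.1 h)
  have hc0 : c 0 = r := by rw [hc]; simp
  have hcp : ∀ μ : Fin d, c (0 + e μ) = if μ = μ₀ then -r else 0 := fun μ => by
    rw [zero_add, hc]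
    simp only [he0 μ, if_false, hee μ]
  have hcm : ∀ μ : Fin d, c (0 - e μ) = 0 := fun μ => by
    rw [zero_sub, hc]
    simp only [hne0' μ, if_false, hne' μ]
  rw [hG]
  congr 1
  simp_rw [hc0, hcp, hcm, sub_zero]
  rw [Finset.sum_sub_distrib, Finset.sum_const, Finset.card_univ, Fintype.card_fin, nsmul_eq_mul,
    Finset.sum_ite_eq' Finset.univ μ₀ (fun _ => -r), if_pos (Finset.mem_univ _)]
  ring

/-- **One-level locality** of the flat stencil: `(Ga)(x)` reads `a` only at `x` and `x ± e_μ`. [cite: Balaban1985BackgroundPropagators, (3.23) p.394] -/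
theorem flatLap_congr_at (hG : ∀ c x, G c x = (η ^ 2)⁻¹ * ∑ μ : Fin d, (2 * c x - c (x + e μ) - c (x - e μ)))
    {a b : Site d → ℝ} {x : Site d} (h0 : a x = b x) (hp : ∀ μ, a (x + e μ) = b (x + e μ))
    (hm : ∀ μ, a (x - e μ) = b (x - e μ)) : G a x = G b x := by
  rw [hG, hG, h0]
  congr 1
  exact Finset.sum_congr rfl fun μ _ => by rw [hp, hm]

/-- **Two-level locality**: `(G(Ga))(x)` reads `a` only at the sites `x + s + t`, `s, t ∈ {0, ±e_μ}`. [cite: Balaban1985BackgroundPropagators, (3.23) p.394] -/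
theorem flatLap_flatLap_congr_at (hG : ∀ c x, G c x = (η ^ 2)⁻¹ * ∑ μ : Fin d, (2 * c x - c (x + e μ) - c (x - e μ)))
    {a b : Site d → ℝ} {x : Site d}
    (h : ∀ s t : Site d, (s = 0 ∨ ∃ μ, s = e μ ∨ s = -e μ) → (t = 0 ∨ ∃ μ, t = e μ ∨ t = -e μ) →
      a (x + s + t) = b (x + s + t)) :
    G (G a) x = G (G b) x := by
  have hs0 : (0 : Site d) = 0 ∨ ∃ μ, (0 : Site d) = e μ ∨ (0 : Site d) = -e μ := Or.inl rfl
  have hsp : ∀ μ : Fin d, e μ = 0 ∨ ∃ ν, e μ = e ν ∨ e μ = -e ν := fun μ => Or.inr ⟨μ, Or.inl rfl⟩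
  have hsm : ∀ μ : Fin d, -e μ = 0 ∨ ∃ ν, -e μ = e ν ∨ -e μ = -e ν := fun μ => Or.inr ⟨μ, Or.inr rfl⟩
  have hloc : ∀ s : Site d, (s = 0 ∨ ∃ μ, s = e μ ∨ s = -e μ) → G a (x + s) = G b (x + s) := fun s hs => by
    refine flatLap_congr_at hG ?_ (fun μ => ?_) (fun μ => ?_)
    · simpa using h s 0 hs hs0
    · exact h s (e μ) hs (hsp μ)
    · rw [sub_eq_add_neg]; exact h s (-e μ) hs (hsm μ)
  refine flatLap_congr_at hG ?_ (fun μ => hloc (e μ) (hsp μ)) (fun μ => ?_)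
  · simpa using hloc 0 hs0
  · rw [sub_eq_add_neg]; exact hloc (-e μ) (hsm μ)

/-- **Translation covariance**: `G(a(v + ·))(x) = (Ga)(v + x)`. [cite: Balaban1985BackgroundPropagators, (3.23) p.394] -/
theorem flatLap_translate (hG : ∀ c x, G c x = (η ^ 2)⁻¹ * ∑ μ : Fin d, (2 * c x - c (x + e μ) - c (x - e μ)))
    (a : Site d → ℝ) (v x : Site d) : G (fun y => a (v + y)) x = G a (v + x) := by
  rw [hG, hG]
  congr 1
  exact Finset.sum_congr rfl fun μ _ => by rw [add_assoc, add_sub_assoc]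

/-- **Homogeneity**: `G(t·a) = t·(Ga)`. [cite: Balaban1985BackgroundPropagators, (3.23) p.394] -/
theorem flatLap_constMul (hG : ∀ c x, G c x = (η ^ 2)⁻¹ * ∑ μ : Fin d, (2 * c x - c (x + e μ) - c (x - e μ)))
    (t : ℝ) (a : Site d → ℝ) (x : Site d) : G (fun y => t * a y) x = t * G a x := by
  rw [hG, hG, Finset.mul_sum, Finset.mul_sum, Finset.mul_sum]
  exact Finset.sum_congr rfl fun μ _ => by ring

end FlatLocality

/-! ## §2 The dipole train `λ_∞ = Σ_{n ≥ 1} n·(δ_{aₙ} − δ_{aₙ+e₀})`, `aₙ = 4n·e₁`: zero block sums, local shape near each dipole -/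

section Train

variable {μ₀ μ₁ : Fin d} {g c : Site d → ℝ} {an : ℕ → Site d}

/-- The train `g` (letter with law `hg`: sign of the `e₀`-coordinate times the axis profile) read at `x ± e₀`: only the sign factor moves.
[cite: Balaban1985RegularSpaces, p.77 (bookkeeping: lattice translations)] -/
theorem train_add_e_apply (h10 : μ₁ ≠ μ₀)
    (hg : ∀ x, g x = (if x μ₀ = 0 then (1 : ℝ) else if x μ₀ = 1 then -1 else 0) *
      (if (∀ ii : Fin d, ii ≠ μ₀ → ii ≠ μ₁ → x ii = 0) ∧ (4 : ℤ) ∣ x μ₁ ∧ 0 < x μ₁ then (((x μ₁ / 4 : ℤ)) : ℝ) else 0))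
    (x : Site d) :
    g (x + e μ₀) = (if x μ₀ + 1 = 0 then (1 : ℝ) else if x μ₀ + 1 = 1 then -1 else 0) *
        (if (∀ ii : Fin d, ii ≠ μ₀ → ii ≠ μ₁ → x ii = 0) ∧ (4 : ℤ) ∣ x μ₁ ∧ 0 < x μ₁ then (((x μ₁ / 4 : ℤ)) : ℝ) else 0) ∧
      g (x - e μ₀) = (if x μ₀ - 1 = 0 then (1 : ℝ) else if x μ₀ - 1 = 1 then -1 else 0) *
        (if (∀ ii : Fin d, ii ≠ μ₀ → ii ≠ μ₁ → x ii = 0) ∧ (4 : ℤ) ∣ x μ₁ ∧ 0 < x μ₁ then (((x μ₁ / 4 : ℤ)) : ℝ) else 0) := by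
  have hcoord_p : ∀ ii : Fin d, ii ≠ μ₀ → (x + e μ₀) ii = x ii := fun ii hii => by
    rw [Pi.add_apply, e_apply, if_neg hii, add_zero]
  have hcoord_m : ∀ ii : Fin d, ii ≠ μ₀ → (x - e μ₀) ii = x ii := fun ii hii => by
    rw [Pi.sub_apply, e_apply, if_neg hii, sub_zero]
  have hp0 : (x + e μ₀) μ₀ = x μ₀ + 1 := by rw [Pi.add_apply, e_apply, if_pos rfl]
  have hm0 : (x - e μ₀) μ₀ = x μ₀ - 1 := by rw [Pi.sub_apply, e_apply, if_pos rfl]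
  have hforall_p : (∀ ii : Fin d, ii ≠ μ₀ → ii ≠ μ₁ → (x + e μ₀) ii = 0) ↔ (∀ ii : Fin d, ii ≠ μ₀ → ii ≠ μ₁ → x ii = 0) :=
    forall_congr' fun ii => ⟨fun h h0 h1 => by rw [← hcoord_p ii h0]; exact h h0 h1,
      fun h h0 h1 => by rw [hcoord_p ii h0]; exact h h0 h1⟩
  have hforall_m : (∀ ii : Fin d, ii ≠ μ₀ → ii ≠ μ₁ → (x - e μ₀) ii = 0) ↔ (∀ ii : Fin d, ii ≠ μ₀ → ii ≠ μ₁ → x ii = 0) :=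
    forall_congr' fun ii => ⟨fun h h0 h1 => by rw [← hcoord_m ii h0]; exact h h0 h1,
      fun h h0 h1 => by rw [hcoord_m ii h0]; exact h h0 h1⟩
  constructor
  · rw [hg, hp0, hcoord_p μ₁ h10]
    simp only [hforall_p]
  · rw [hg, hm0, hcoord_m μ₁ h10]
    simp only [hforall_m]

/-- ★ **The train has zero sum on every `L`-block** (`L ≥ 2`): the involution `x ↦ x ± e₀` swapping the `e₀`-coordinates `0 ↔ 1` preserves each
`L`-block and reverses the sign of `g` (`Finset.sum_involution`).  This is the constraint `Q′₁(1)λ_∞ = 0` of «`f ∈ R(1)`» at the depth-one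
LamTop member. [cite: Balaban1985RegularSpaces, (1.146) p.101 («R(U₀)f = f»), (1.29) p.81; Balaban1985BackgroundPropagators, (3.19)–(3.21) pp.393–394] -/
theorem train_blockSum_zero {𝔸 : Type*} [AddCommGroup 𝔸] [Module ℝ 𝔸] {L : ℕ} (hL : 2 ≤ L) (h10 : μ₁ ≠ μ₀)
    (hg : ∀ x, g x = (if x μ₀ = 0 then (1 : ℝ) else if x μ₀ = 1 then -1 else 0) *
      (if (∀ ii : Fin d, ii ≠ μ₀ → ii ≠ μ₁ → x ii = 0) ∧ (4 : ℤ) ∣ x μ₁ ∧ 0 < x μ₁ then (((x μ₁ / 4 : ℤ)) : ℝ) else 0))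
    (v : 𝔸) (y : Site d) : ∑ x ∈ blockSites L y, g x • v = 0 := by
  classical
  haveI : NeZero L := ⟨by omega⟩
  have he0 : e μ₀ ≠ (0 : Site d) := fun h => by
    have h1 := congrArg (fun x : Site d => x μ₀) h
    rw [e_apply, if_pos rfl, Pi.zero_apply] at h1
    exact one_ne_zero h1
  -- the involution
  obtain ⟨τ, hτ⟩ : ∃ τ : Site d → Site d, ∀ x, τ x = if x μ₀ = 0 then x + e μ₀ else if x μ₀ = 1 then x - e μ₀ else x :=
    ⟨fun x => if x μ₀ = 0 then x + e μ₀ else if x μ₀ = 1 then x - e μ₀ else x, fun _ => rfl⟩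
  have hτ0 : ∀ x : Site d, x μ₀ = 0 → τ x = x + e μ₀ := fun x h0 => by rw [hτ, if_pos h0]
  have hτ1 : ∀ x : Site d, x μ₀ = 1 → τ x = x - e μ₀ := fun x h1 => by
    rw [hτ, if_neg (by rw [h1]; exact one_ne_zero), if_pos h1]
  have hτ2 : ∀ x : Site d, x μ₀ ≠ 0 → x μ₀ ≠ 1 → τ x = x := fun x h0 h1 => by rw [hτ, if_neg h0, if_neg h1]
  have hp0 : ∀ x : Site d, (x + e μ₀) μ₀ = x μ₀ + 1 := fun x => by rw [Pi.add_apply, e_apply, if_pos rfl]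
  have hm0 : ∀ x : Site d, (x - e μ₀) μ₀ = x μ₀ - 1 := fun x => by rw [Pi.sub_apply, e_apply, if_pos rfl]
  have hg2 : ∀ x : Site d, x μ₀ ≠ 0 → x μ₀ ≠ 1 → g x = 0 := fun x h0 h1 => by
    rw [hg, if_neg h0, if_neg h1, zero_mul]
  have hgτ : ∀ x, g (τ x) = -g x := fun x => by
    by_cases h0 : x μ₀ = 0
    · rw [hτ0 x h0, (train_add_e_apply h10 hg x).1, hg x, h0]
      norm_num
      split_ifs <;> simp
    · by_cases h1 : x μ₀ = 1
      · rw [hτ1 x h1, (train_add_e_apply h10 hg x).2, hg x, h1]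
        norm_num
        split_ifs <;> simp
      · rw [hτ2 x h0 h1, hg2 x h0 h1, neg_zero]
  have hττ : ∀ x, τ (τ x) = x := fun x => by
    by_cases h0 : x μ₀ = 0
    · have h1' : (x + e μ₀) μ₀ = 1 := by rw [hp0, h0, zero_add]
      rw [hτ0 x h0, hτ1 _ h1', add_sub_cancel_right]
    · by_cases h1 : x μ₀ = 1
      · have h0' : (x - e μ₀) μ₀ = 0 := by rw [hm0, h1, sub_self]
        rw [hτ1 x h1, hτ0 _ h0', sub_add_cancel]
      · rw [hτ2 x h0 h1, hτ2 x h0 h1]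
  have hτne : ∀ x, g x ≠ 0 → τ x ≠ x := fun x hx => by
    by_cases h0 : x μ₀ = 0
    · rw [hτ0 x h0]; intro h; exact he0 (by simpa using h)
    · by_cases h1 : x μ₀ = 1
      · rw [hτ1 x h1]; intro h
        apply he0
        have h' : x - (x - e μ₀) = x - x := by rw [h]
        simpa using h'
      · exact absurd (hg2 x h0 h1) hx
  have hτblock : ∀ x, blockMap L (τ x) = blockMap L x := fun x => by
    have hL2 : (2 : ℤ) ≤ (L : ℤ) := by exact_mod_cast hL
    by_cases h0 : x μ₀ = 0
    · rw [hτ0 x h0]; funext ii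
      rw [B7BlockGeometry.blockMap_apply, B7BlockGeometry.blockMap_apply]
      by_cases hii : ii = μ₀
      · rw [hii, hp0, h0, zero_add, Int.zero_ediv]
        exact Int.ediv_eq_zero_of_lt (by norm_num) (by omega)
      · rw [Pi.add_apply, e_apply, if_neg hii, add_zero]
    · by_cases h1 : x μ₀ = 1
      · rw [hτ1 x h1]; funext ii
        rw [B7BlockGeometry.blockMap_apply, B7BlockGeometry.blockMap_apply]
        by_cases hii : ii = μ₀
        · rw [hii, hm0, h1, sub_self, Int.zero_ediv]
          exact (Int.ediv_eq_zero_of_lt (by norm_num) (by omega)).symm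
        · rw [Pi.sub_apply, e_apply, if_neg hii, sub_zero]
      · rw [hτ2 x h0 h1]
  refine Finset.sum_involution (fun x _ => τ x) (fun x _ => ?_) (fun x _ hx => ?_) (fun x hx => ?_) (fun x _ => hττ x)
  · rw [hgτ, ← add_smul, add_neg_cancel, zero_smul]
  · refine hτne x fun h => hx ?_
    rw [h, zero_smul]
  · rw [mem_blockSites_iff] at hx ⊢
    rw [hτblock, hx]

/-- **Near the `n`-th dipole the train IS `n·c`**: for `aₙ = 4n·e₁` (letter `an`, law `han`) and `|y₁| ≤ 3`, `g(aₙ + y) = n·c(y)` with the unit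
dipole `c = δ₀ − δ_{e₀}` — the trains are `4` apart along `e₁`, so no other dipole is seen. [cite: Balaban1985RegularSpaces, p.77 (bookkeeping)] -/
theorem train_near_dipole (h10 : μ₁ ≠ μ₀)
    (hg : ∀ x, g x = (if x μ₀ = 0 then (1 : ℝ) else if x μ₀ = 1 then -1 else 0) *
      (if (∀ ii : Fin d, ii ≠ μ₀ → ii ≠ μ₁ → x ii = 0) ∧ (4 : ℤ) ∣ x μ₁ ∧ 0 < x μ₁ then (((x μ₁ / 4 : ℤ)) : ℝ) else 0))
    (han : ∀ (n : ℕ) (ii : Fin d), an n ii = if ii = μ₁ then 4 * (n : ℤ) else 0)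
    (hc : ∀ x, c x = if x = 0 then (1 : ℝ) else if x = e μ₀ then -1 else 0)
    {n : ℕ} (hn : 1 ≤ n) {y : Site d} (hy1 : -3 ≤ y μ₁) (hy2 : y μ₁ ≤ 3) :
    g (an n + y) = (n : ℝ) * c y := by
  have h01 : μ₀ ≠ μ₁ := fun h => h10 h.symm
  have hy0μ : (an n + y) μ₀ = y μ₀ := by rw [Pi.add_apply, han, if_neg h01, zero_add]
  have hy1μ : (an n + y) μ₁ = 4 * (n : ℤ) + y μ₁ := by rw [Pi.add_apply, han, if_pos rfl]
  have hyi : ∀ ii : Fin d, ii ≠ μ₁ → (an n + y) ii = y ii := fun ii hii => by rw [Pi.add_apply, han, if_neg hii, zero_add]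
  have hA : ((∀ ii : Fin d, ii ≠ μ₀ → ii ≠ μ₁ → (an n + y) ii = 0) ∧ (4 : ℤ) ∣ (an n + y) μ₁ ∧ 0 < (an n + y) μ₁) ↔
      ((∀ ii : Fin d, ii ≠ μ₀ → ii ≠ μ₁ → y ii = 0) ∧ y μ₁ = 0) := by
    rw [hy1μ]
    constructor
    · rintro ⟨h1, h2, -⟩
      exact ⟨fun ii h0' h1' => by rw [← hyi ii h1']; exact h1 ii h0' h1', by omega⟩
    · rintro ⟨h1, h2⟩
      refine ⟨fun ii h0' h1' => by rw [hyi ii h1']; exact h1 ii h0' h1', ?_, by omega⟩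
      rw [h2, add_zero]; exact dvd_mul_right 4 _
  have hval : y μ₁ = 0 → (((4 * (n : ℤ) + y μ₁) / 4 : ℤ) : ℝ) = n := fun h2 => by
    rw [h2, add_zero]
    have : (4 * (n : ℤ)) / 4 = n := by omega
    rw [this]; push_cast; ring
  rw [hg, hy0μ, hy1μ, hc]
  by_cases hA' : (∀ ii : Fin d, ii ≠ μ₀ → ii ≠ μ₁ → y ii = 0) ∧ y μ₁ = 0
  · -- on the axis of the dipole: `y = (y μ₀)·e₀`
    have hcond : (∀ ii : Fin d, ii ≠ μ₀ → ii ≠ μ₁ → (an n + y) ii = 0) ∧ (4 : ℤ) ∣ 4 * (n : ℤ) + y μ₁ ∧ 0 < 4 * (n : ℤ) + y μ₁ := by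
      rw [← hy1μ]; exact hA.2 hA'
    rw [if_pos hcond, hval hA'.2]
    have hyshape : ∀ t : ℤ, y μ₀ = t → y = fun ii => if ii = μ₀ then t else 0 := fun t ht => by
      funext ii
      by_cases hii0 : ii = μ₀
      · rw [hii0, if_pos rfl, ht]
      · rw [if_neg hii0]
        by_cases hii1 : ii = μ₁
        · rw [hii1]; exact hA'.2
        · exact hA'.1 ii hii0 hii1
    by_cases h0 : y μ₀ = 0
    · have hy : y = 0 := by rw [hyshape 0 h0]; funext ii; simp
      rw [if_pos h0, if_pos hy]; ring
    · by_cases h1 : y μ₀ = 1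
      · have hy : y = e μ₀ := by
          rw [hyshape 1 h1]; funext ii; rw [e_apply]
        have hy0 : y ≠ 0 := fun h => by rw [h, Pi.zero_apply] at h1; exact zero_ne_one h1
        rw [if_neg h0, if_pos h1, if_neg hy0, if_pos hy]; ring
      · have hy0 : y ≠ 0 := fun h => h0 (by rw [h, Pi.zero_apply])
        have hy1 : y ≠ e μ₀ := fun h => h1 (by rw [h, e_apply, if_pos rfl])
        rw [if_neg h0, if_neg h1, if_neg hy0, if_neg hy1]; ring
  · -- off the axis: both sides vanish
    have hcond : ¬ ((∀ ii : Fin d, ii ≠ μ₀ → ii ≠ μ₁ → (an n + y) ii = 0) ∧ (4 : ℤ) ∣ 4 * (n : ℤ) + y μ₁ ∧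
        0 < 4 * (n : ℤ) + y μ₁) := fun h => hA' (hA.1 (by rw [hy1μ]; exact h))
    have hy0 : y ≠ 0 := fun h => hA' ⟨fun ii _ _ => by rw [h, Pi.zero_apply], by rw [h, Pi.zero_apply]⟩
    have hy1 : y ≠ e μ₀ := fun h => hA' ⟨fun ii hii _ => by rw [h, e_apply, if_neg hii], by rw [h, e_apply, if_neg h10]⟩
    rw [if_neg hcond, if_neg hy0, if_neg hy1]; ring

/-- Steps `s ∈ {0, ±e_μ}` have coordinates in `[−1, 1]`. [folklore] [cite: Balaban1985RegularSpaces, p.77 (bookkeeping)] -/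
theorem abs_step_apply_le {s : Site d} (hs : s = 0 ∨ ∃ μ, s = e μ ∨ s = -e μ) (ν : Fin d) : -1 ≤ s ν ∧ s ν ≤ 1 := by
  rcases hs with rfl | ⟨μ, rfl | rfl⟩
  · simp
  · rw [e_apply]; split_ifs <;> norm_num
  · rw [Pi.neg_apply, e_apply]; split_ifs <;> norm_num

variable {η : ℝ} {G : (Site d → ℝ) → Site d → ℝ}

/-- `(Gg)(aₙ) = n·(Gc)(0)` — one-level locality + translation covariance + homogeneity. [cite: Balaban1985BackgroundPropagators, (3.23) p.394] -/
theorem train_flatLap_at (h10 : μ₁ ≠ μ₀)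
    (hG : ∀ c x, G c x = (η ^ 2)⁻¹ * ∑ μ : Fin d, (2 * c x - c (x + e μ) - c (x - e μ)))
    (hg : ∀ x, g x = (if x μ₀ = 0 then (1 : ℝ) else if x μ₀ = 1 then -1 else 0) *
      (if (∀ ii : Fin d, ii ≠ μ₀ → ii ≠ μ₁ → x ii = 0) ∧ (4 : ℤ) ∣ x μ₁ ∧ 0 < x μ₁ then (((x μ₁ / 4 : ℤ)) : ℝ) else 0))
    (han : ∀ (n : ℕ) (ii : Fin d), an n ii = if ii = μ₁ then 4 * (n : ℤ) else 0)
    (hc : ∀ x, c x = if x = 0 then (1 : ℝ) else if x = e μ₀ then -1 else 0) {n : ℕ} (hn : 1 ≤ n) :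
    G g (an n) = (n : ℝ) * G c 0 := by
  have h := flatLap_translate hG g (an n) 0
  rw [add_zero] at h
  rw [← h]
  have hcongr : G (fun y => g (an n + y)) 0 = G (fun y => (n : ℝ) * c y) 0 := by
    refine flatLap_congr_at hG ?_ (fun μ => ?_) (fun μ => ?_)
    · exact train_near_dipole h10 hg han hc hn (by simp) (by simp)
    · have h1 := abs_step_apply_le (Or.inr ⟨μ, Or.inl rfl⟩ : e μ = 0 ∨ ∃ ν, e μ = e ν ∨ e μ = -e ν) μ₁
      exact train_near_dipole h10 hg han hc hn (y := 0 + e μ) (by simp only [Pi.add_apply, Pi.zero_apply]; omega)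
        (by simp only [Pi.add_apply, Pi.zero_apply]; omega)
    · have h1 := abs_step_apply_le (Or.inr ⟨μ, Or.inr rfl⟩ : -e μ = 0 ∨ ∃ ν, -e μ = e ν ∨ -e μ = -e ν) μ₁
      rw [sub_eq_add_neg]
      exact train_near_dipole h10 hg han hc hn (y := 0 + -e μ) (by simp only [Pi.add_apply, Pi.zero_apply]; omega)
        (by simp only [Pi.add_apply, Pi.zero_apply]; omega)
  rw [hcongr, flatLap_constMul hG]

/-- `(G(Gg))(aₙ + x) = n·(G(Gc))(x)` for `x ∈ {0, e₀}` — two-level locality + translation covariance + homogeneity.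
[cite: Balaban1985BackgroundPropagators, (3.23) p.394] -/
theorem train_flatLap_flatLap_at (h10 : μ₁ ≠ μ₀)
    (hG : ∀ c x, G c x = (η ^ 2)⁻¹ * ∑ μ : Fin d, (2 * c x - c (x + e μ) - c (x - e μ)))
    (hg : ∀ x, g x = (if x μ₀ = 0 then (1 : ℝ) else if x μ₀ = 1 then -1 else 0) *
      (if (∀ ii : Fin d, ii ≠ μ₀ → ii ≠ μ₁ → x ii = 0) ∧ (4 : ℤ) ∣ x μ₁ ∧ 0 < x μ₁ then (((x μ₁ / 4 : ℤ)) : ℝ) else 0))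
    (han : ∀ (n : ℕ) (ii : Fin d), an n ii = if ii = μ₁ then 4 * (n : ℤ) else 0)
    (hc : ∀ x, c x = if x = 0 then (1 : ℝ) else if x = e μ₀ then -1 else 0) {n : ℕ} (hn : 1 ≤ n)
    {x : Site d} (hx : x = 0 ∨ x = e μ₀) :
    G (G g) (an n + x) = (n : ℝ) * G (G c) x := by
  have hxμ₁ : x μ₁ = 0 := by
    rcases hx with rfl | rfl
    · rfl
    · rw [e_apply, if_neg h10]
  have htr : (fun y => G g (an n + y)) = G (fun y => g (an n + y)) :=
    funext fun y => (flatLap_translate hG g (an n) y).symm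
  rw [← flatLap_translate hG (G g) (an n) x, htr]
  have hcongr : G (G (fun y => g (an n + y))) x = G (G (fun y => (n : ℝ) * c y)) x := by
    refine flatLap_flatLap_congr_at hG fun s t hs ht => ?_
    have h1 := abs_step_apply_le hs μ₁
    have h2 := abs_step_apply_le ht μ₁
    exact train_near_dipole h10 hg han hc hn (y := x + s + t) (by simp only [Pi.add_apply]; omega)
      (by simp only [Pi.add_apply]; omega)
  rw [hcongr, show G (fun y => (n : ℝ) * c y) = fun y => (n : ℝ) * G c y from funext fun y => flatLap_constMul hG _ c y,
    flatLap_constMul hG]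

end Train

/-! ## §3 THE SECOND HOLE: an unbounded HERMITIAN source of «norm 0» refutes Theorem 8's surviving form at the depth-one LamTop member -/

section Unbounded

variable {𝔸 : Type} [CStarAlgebra 𝔸] [Nontrivial 𝔸]

omit [Nontrivial 𝔸] in
/-- At a LamTop member (`Λ_j = {j = k}`, `k ≥ 1`) the flat transpose `Q′(1)ᵀμ` takes the same value at two sites lying in the same `Lʲ`-block for
every `j ≥ 1` (`B8Eq191FlatStencils.QT_flat_apply`; the level-`0` term is `𝟙_∅`). [cite: Balaban1985BackgroundPropagators, (3.19) p.393, (3.24) p.394; Balaban1985RegularSpaces, (1.29) p.81] -/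
theorem QT_flat_lamTop_eq_of_blockMap {L : ℕ} {k : ℕ} (hk : 1 ≤ k) {Λ : ℕ → Set (Site d)}
    (hΛ : ∀ j, Λ j = {_y | j = k}) (μ : ℕ → Site d → 𝔸) {x x' : Site d}
    (hb : ∀ j, 1 ≤ j → blockMap (L ^ j) x = blockMap (L ^ j) x') :
    QT L k Λ (1 : Site d → Fin d → 𝔸ˣ) μ x = QT L k Λ (1 : Site d → Fin d → 𝔸ˣ) μ x' := by
  rw [QT_flat_apply, QT_flat_apply]
  refine Finset.sum_congr rfl fun j _ => ?_
  rcases Nat.eq_zero_or_pos j with rfl | hjpos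
  · have h0 : Λ 0 = ∅ := by
      rw [hΛ]; ext y; simp only [Set.mem_setOf_eq, Set.mem_empty_iff_false, iff_false]; omega
    simp only [h0, Set.indicator_empty]
  · rw [hb j hjpos]

omit [Nontrivial 𝔸] in
/-- A crude bound for the flat divergence: `‖D^{η*}_1A(x)‖ ≤ d·η⁻¹·2·sup‖A‖` (`η > 0`). [cite: Balaban1985RegularSpaces, (1.1) p.76] -/
theorem norm_covDivB_flat_le {η : ℝ} (hη : 0 < η) {A : Site d → Fin d → 𝔸} {M : ℝ} (hA : ∀ y ν, ‖A y ν‖ ≤ M) (x : Site d) :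
    ‖covDivB η (1 : Site d → Fin d → 𝔸ˣ) A x‖ ≤ d * (η⁻¹ * (2 * M)) := by
  unfold covDivB
  calc ‖∑ ν : Fin d, covDeriv η (1 : Site d → Fin d → 𝔸ˣ) ν (fun y => A y ν) x‖
      ≤ ∑ ν : Fin d, ‖covDeriv η (1 : Site d → Fin d → 𝔸ˣ) ν (fun y => A y ν) x‖ := norm_sum_le _ _
    _ ≤ ∑ _ν : Fin d, η⁻¹ * (2 * M) := by
        refine Finset.sum_le_sum fun ν _ => ?_
        rw [covDeriv_flat_apply, norm_smul, Real.norm_eq_abs, abs_of_pos (inv_pos.2 hη)]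
        refine mul_le_mul_of_nonneg_left ?_ (inv_pos.2 hη).le
        calc ‖A (x - e ν) ν - A x ν‖ ≤ ‖A (x - e ν) ν‖ + ‖A x ν‖ := norm_sub_le _ _
          _ ≤ M + M := add_le_add (hA _ _) (hA _ _)
          _ = 2 * M := by ring
    _ = d * (η⁻¹ * (2 * M)) := by rw [Finset.sum_const, Finset.card_univ, Fintype.card_fin, nsmul_eq_mul]

/-- ★★ **THE BODY OF `Thm8SurvivingAt` FAILS ON A HERMITIAN SOURCE, through the unbounded-source hole.**  At any `zdGF3` member with
`Ω_j = ℤᵈ`, `Λs m j = {j = m}` and depth `k = 1` (`d ≥ 2`, `L ≥ 2`; any `β, len, γ > 0, B₁`), for every threshold `c₁ > 0` there are admissible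
data — `α₀ = α₁ = c₁/2`, `U₀ = U′ = 1` ((1.33) `one_inAk`, (1.34) `inAx_self`, (1.35) trivially) and a **Hermitian** source `f = Δ^η_1λ_∞`,
`λ_∞ = Σ_{n≥1} n·(δ_{aₙ} − δ_{aₙ+e₀})·1`, `aₙ = 4n·e₁`, with `InR U₀ f` (`train_blockSum_zero`) and `fNorm f < γ(α₀ + α₁)` (the weighted family
is UNBOUNDED, `‖f(aₙ)‖ = n(2d+1)η⁻²`, so `msup = 0` by `Real.iSup_of_not_bddAbove`) — for which NO gauge transformation `u` satisfies
`C162 B₁ (α₀+α₁) U₀ (act U′ u) ∧ LandauF U₀ f (act U′ u)`: (1.62) bounds `Δ^η_1D^{η*}_1A′` by `M₂` uniformly, (1.146) at `aₙ` minus at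
`aₙ + e₀` kills the multiplier (`QT_flat_lamTop_eq_of_blockMap`) and leaves `n·κ ≤ 2M₂` (`κ > 0`, `flatLap_dipole_pos`), false for
`n > 2M₂/κ`.  So a Hermitian clause alone does NOT repair `Src ∕ InR`; finiteness of `|f|₍₋₂₎` must be typed too.
[cite: Balaban1985RegularSpaces, Thm 8 (1.146) p.101, p.86 (definition after (1.55)), (1.62) p.87, (1.33)–(1.35) p.82, (1.29) p.81, p.77 («Ω_j = T_η»); Balaban1985BackgroundPropagators, (3.19)–(3.25) pp.393–394] -/
theorem thm8Surviving_fails_hermitian_unbounded_source (hd2 : 2 ≤ d) {L : ℕ} (hL : 2 ≤ L) (β : ℝ) (len : Site d → ℝ)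
    {γ : ℝ} (hγ : 0 < γ) (B₁ : ℝ) (i : ZdIdx d L)
    (hΩ : ∀ j, i.Ω j = Set.univ) (hΛ : ∀ m j, i.Λs m j = {_y | j = m}) (hk1 : i.k = 1) {c₁ : ℝ} (hc₁ : 0 < c₁) :
    ∃ (α₀ α₁ : ℝ) (U₀ : (zdGF3 𝔸 L β len i).Cfg) (U' : (zdGF3 𝔸 L β len i).Pert) (f : Site d → 𝔸),
      0 < α₀ ∧ 0 < α₁ ∧ α₀ + α₁ ≤ c₁ ∧ (∀ x, IsSelfAdjoint (f x)) ∧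
      (zdGF3 𝔸 L β len i).InA α₀ U₀ ∧ (zdGF3 𝔸 L β len i).InAAx α₀ U₀ U' ∧ (zdGF3 𝔸 L β len i).avgClose α₁ U₀ U' ∧
      (zdGF3 𝔸 L β len i).InR U₀ f ∧ (zdGF3 𝔸 L β len i).fNorm f < γ * (α₀ + α₁) ∧
      ¬ ∃ u : (zdGF3 𝔸 L β len i).GT, (zdGF3 𝔸 L β len i).C162 B₁ (α₀ + α₁) U₀ ((zdGF3 𝔸 L β len i).act U' u) ∧
          (zdGF3 𝔸 L β len i).LandauF U₀ f ((zdGF3 𝔸 L β len i).act U' u) := by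
  classical
  have hL1 : 1 ≤ L := le_trans (by norm_num) hL
  have hd0 : 0 < d := by omega
  have hd1 : 1 < d := by omega
  have hη := i.hη
  have hk := i.hk
  set μ₀ : Fin d := ⟨0, hd0⟩ with hμ₀
  set μ₁ : Fin d := ⟨1, hd1⟩ with hμ₁
  have h10 : μ₁ ≠ μ₀ := fun h => by
    have h' := congrArg Fin.val h
    simp only [hμ₀, hμ₁] at h'
    exact one_ne_zero h'
  have h01 : μ₀ ≠ μ₁ := fun h => h10 h.symm
  have he : ∀ μ ν : Fin d, e μ ν = if ν = μ then 1 else 0 := fun μ ν => e_apply μ ν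
  -- smallness parameters and data `U₀ = U′ = 1`
  set α : ℝ := c₁ / 2 with hα_def
  have hα : 0 < α := by positivity
  have hαc : α + α ≤ c₁ := by rw [hα_def]; linarith
  have h1u : ∀ x κ, (1 : Site d → Fin d → 𝔸ˣ) x κ ∈ unitaryUnits 𝔸 := fun _ _ => (unitaryUnits 𝔸).one_mem
  let U₀ : (zdGF3 𝔸 L β len i).Cfg := ⟨1, h1u⟩
  let P : (zdGF3 𝔸 L β len i).Pert := (⟨1, h1u⟩, ⟨1, h1u⟩)
  have hmul : mulCfg (1 : Site d → Fin d → 𝔸ˣ) (1 : Site d → Fin d → 𝔸ˣ) = 1 := by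
    rw [B8Thm4Concrete.mulCfg_eq_mul, mul_one]
  have hInA : (zdGF3 𝔸 L β len i).InA α U₀ := B8Prop6OfThm4.one_inAk hL1 i.k hη hα _
  have hInAAx : (zdGF3 𝔸 L β len i).InAAx α U₀ P := by
    refine ⟨rfl, ?_, ?_⟩
    · show InAk L i.k i.η α i.Ω (mulCfg 1 1)
      rw [hmul]
      exact B8Prop6OfThm4.one_inAk hL1 i.k hη hα _
    · intro m _
      show InAx L m (i.Λs m) 1 (mulCfg 1 1)
      rw [hmul]
      exact inAx_self L m (i.Λs m) 1
  have havg : (zdGF3 𝔸 L β len i).avgClose α U₀ P := by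
    intro j _ z μ _
    show ‖(avgIter L (mulCfg (1 : Site d → Fin d → 𝔸ˣ) 1) j z μ : 𝔸) - (avgIter L (1 : Site d → Fin d → 𝔸ˣ) j z μ : 𝔸)‖ ≤ α
    rw [hmul, sub_self, norm_zero]
    exact hα.le
  -- letters: the flat scalar Laplacian `G`, the unit dipole `c`, the train `g`, the sites `aₙ`
  obtain ⟨G, hG⟩ : ∃ G : (Site d → ℝ) → Site d → ℝ,
      ∀ c x, G c x = (i.η ^ 2)⁻¹ * ∑ μ : Fin d, (2 * c x - c (x + e μ) - c (x - e μ)) :=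
    ⟨fun c x => (i.η ^ 2)⁻¹ * ∑ μ : Fin d, (2 * c x - c (x + e μ) - c (x - e μ)), fun _ _ => rfl⟩
  obtain ⟨c, hc⟩ : ∃ c : Site d → ℝ, c = fun x => if x = 0 then (1 : ℝ) else if x = e μ₀ then -1 else 0 := ⟨_, rfl⟩
  have hcx : ∀ x, c x = if x = 0 then (1 : ℝ) else if x = e μ₀ then -1 else 0 := fun x => by rw [hc]
  obtain ⟨g, hg⟩ : ∃ g : Site d → ℝ, ∀ x, g x = (if x μ₀ = 0 then (1 : ℝ) else if x μ₀ = 1 then -1 else 0) *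
      (if (∀ ii : Fin d, ii ≠ μ₀ → ii ≠ μ₁ → x ii = 0) ∧ (4 : ℤ) ∣ x μ₁ ∧ 0 < x μ₁ then (((x μ₁ / 4 : ℤ)) : ℝ) else 0) :=
    ⟨fun x => (if x μ₀ = 0 then (1 : ℝ) else if x μ₀ = 1 then -1 else 0) *
      (if (∀ ii : Fin d, ii ≠ μ₀ → ii ≠ μ₁ → x ii = 0) ∧ (4 : ℤ) ∣ x μ₁ ∧ 0 < x μ₁ then (((x μ₁ / 4 : ℤ)) : ℝ) else 0),
      fun _ => rfl⟩
  obtain ⟨an, han⟩ : ∃ an : ℕ → Site d, ∀ (n : ℕ) (ii : Fin d), an n ii = if ii = μ₁ then 4 * (n : ℤ) else 0 :=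
    ⟨fun n ii => if ii = μ₁ then 4 * (n : ℤ) else 0, fun _ _ => rfl⟩
  set K : ℝ := G c 0 with hK
  have hKval : K = (i.η ^ 2)⁻¹ * ((2 * d + 1) * 1) := flatLap_dipole_at_zero hG 1 μ₀ hc
  have hKpos : 0 < K := by rw [hKval]; positivity
  set κ : ℝ := G (G c) 0 - G (G c) (e μ₀) with hκ
  have hκpos : 0 < κ := flatLap_dipole_pos hη.ne' hG one_pos μ₀ hc
  -- the source `f = Δ^η_1(g•1)`: Hermitian, in `R(1)`, of «norm 0»
  set lamR : Site d → 𝔸 := fun x => g x • (1 : 𝔸) with hlamR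
  set f : Site d → 𝔸 := covLap i.η (1 : Site d → Fin d → 𝔸ˣ) lamR with hf_def
  have hfG : ∀ x, f x = G g x • (1 : 𝔸) := fun x => by rw [hf_def, hlamR, covLap_flat_realSmul_one, hG]
  have hfsa : ∀ x, IsSelfAdjoint (f x) := fun x => by
    rw [hfG]; unfold IsSelfAdjoint; rw [star_smul, star_one, star_trivial]
  have hInR : (zdGF3 𝔸 L β len i).InR U₀ f := by
    refine ⟨lamR, fun j hj y hy => ?_, fun x _ => by rw [hΩ 0, Set.indicator_univ]⟩
    rw [hΛ, hk1] at hy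
    have hjk : j = 1 := hy
    subst hjk
    rw [hΩ 0, Set.indicator_univ, bgT_one, B7Eq214FlatQprime.QprimeIter_one_eq_sum_blockSites hL1 lamR 1 y,
      ← Finset.smul_sum, pow_one, train_blockSum_zero hL h10 hg (1 : 𝔸) y, smul_zero]
  have hG1 : ∀ n : ℕ, 1 ≤ n → G g (an n) = (n : ℝ) * K := fun n hn => train_flatLap_at h10 hG hg han hcx hn
  have hw0 : 0 < B8ScaledSupNorm.weight L i.η (-(2 : ℝ)) 0 := B8ScaledSupNorm.weight_pos hL1 hη _ 0
  have hfN : (zdGF3 𝔸 L β len i).fNorm f < γ * (α + α) := by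
    show B8ScaledSupNorm.msup L i.k i.η (-(2 : ℝ)) (fun j (x : Site d) => x ∈ i.Ω j) f < γ * (α + α)
    have hnb : ¬ BddAbove (Set.range fun p : B8ScaledSupNorm.Idx i.k (fun j (x : Site d) => x ∈ i.Ω j) =>
        B8ScaledSupNorm.weight L i.η (-(2 : ℝ)) p.1.1 * ‖f p.1.2‖) := by
      rintro ⟨M, hM⟩
      obtain ⟨n₀, hn₀⟩ := exists_nat_gt (M / (B8ScaledSupNorm.weight L i.η (-(2 : ℝ)) 0 * K))
      have hwK : 0 < B8ScaledSupNorm.weight L i.η (-(2 : ℝ)) 0 * K := mul_pos hw0 hKpos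
      have hnM : M < ((n₀ + 1 : ℕ) : ℝ) * (B8ScaledSupNorm.weight L i.η (-(2 : ℝ)) 0 * K) := by
        have h1 : M / (B8ScaledSupNorm.weight L i.η (-(2 : ℝ)) 0 * K) < ((n₀ + 1 : ℕ) : ℝ) := by
          refine lt_trans hn₀ ?_; push_cast; linarith
        exact (div_lt_iff₀ hwK).1 h1
      let p : B8ScaledSupNorm.Idx i.k (fun j (x : Site d) => x ∈ i.Ω j) :=
        ⟨(0, an (n₀ + 1)), Nat.zero_le _, by show an (n₀ + 1) ∈ i.Ω 0; rw [hΩ 0]; exact Set.mem_univ _⟩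
      have hp : B8ScaledSupNorm.weight L i.η (-(2 : ℝ)) 0 * ‖f (an (n₀ + 1))‖ ≤ M := hM ⟨p, rfl⟩
      rw [hfG, hG1 (n₀ + 1) (by omega), norm_smul, norm_one, mul_one, Real.norm_eq_abs, abs_of_pos (by positivity)] at hp
      linarith
    unfold B8ScaledSupNorm.msup
    rw [Real.iSup_of_not_bddAbove hnb]
    positivity
  refine ⟨α, α, U₀, P, f, hα, hα, hαc, hfsa, hInA, hInAAx, havg, hInR, hfN, ?_⟩
  -- no `u` can satisfy (1.62) and (1.146) for this source
  rintro ⟨u, h162, h146⟩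
  set W : Site d → Fin d → 𝔸ˣ := ((zdGF3 𝔸 L β len i).act P u).2.1 with hW
  -- (1.62) at `j = 0` on `Ω₀ = ℤᵈ`: a uniform bound on the exponent field `A′`, hence on `Δ^η_1D^{η*}_1A′`
  set Mₐ : ℝ := |B₁| * (α + α) * i.η⁻¹ with hMₐ
  have hA' : ∀ y τ', ‖logCfg i.η W y τ'‖ ≤ Mₐ := fun y τ' => by
    have hmem : (y, τ') ∈ {b : Site d × Fin d | B8Eq140Level.SideTouches (i.Ω 0) b.1 b.2} := by
      rw [Set.mem_setOf_eq, hΩ 0]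
      haveI : Nontrivial (Fin d) := Fin.nontrivial_iff_two_le.mpr hd2
      obtain ⟨κ', hκ'⟩ := exists_ne τ'
      exact B8Eq140Level.sideTouches_of_bondTouches hκ' (Or.inl (Set.mem_univ _))
    have h := (h162 0 (Nat.zero_le _) (y, τ') hmem).2.2
    have h' : ‖logCfg i.η W y τ'‖ ≤ B₁ * (α + α) * i.η⁻¹ := by simpa only [pow_zero, one_mul] using h
    refine h'.trans ?_
    rw [hMₐ]
    exact mul_le_mul_of_nonneg_right (mul_le_mul_of_nonneg_right (le_abs_self B₁) (by positivity)) (inv_pos.2 hη).le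
  set M₁ : ℝ := d * (i.η⁻¹ * (2 * Mₐ)) with hM₁
  have hdiv : ∀ x, ‖covDivB i.η (1 : Site d → Fin d → 𝔸ˣ) (logCfg i.η W) x‖ ≤ M₁ := fun x => norm_covDivB_flat_le hη hA' x
  set M₂ : ℝ := d * ((i.η ^ 2)⁻¹ * (4 * M₁)) with hM₂
  set D : Site d → 𝔸 := covLap i.η (1 : Site d → Fin d → 𝔸ˣ) (covDivB i.η (1 : Site d → Fin d → 𝔸ˣ) (logCfg i.η W)) with hD
  have hDb : ∀ x, ‖D x‖ ≤ M₂ := fun x => norm_covLap_flat_le i.η hdiv x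
  -- (1.146) in multiplier form on `ℤᵈ`
  obtain ⟨-, μ, hμ⟩ := h146
  have hE : ∀ x, covLap i.η (1 : Site d → Fin d → 𝔸ˣ) (covDivB i.η (1 : Site d → Fin d → 𝔸ˣ) (logCfg i.η W) - f) x =
      QT L i.k (i.Λs i.k) (1 : Site d → Fin d → 𝔸ˣ) μ x := fun x => by
    have h := hμ x (by rw [hΩ 0]; exact Set.mem_univ x)
    rwa [hΩ 0, Set.indicator_univ] at h
  -- pick the dipole `n` so large that `n·κ > 2M₂`
  obtain ⟨n₀, hn₀⟩ := exists_nat_gt (2 * M₂ / κ)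
  set n : ℕ := n₀ + 1 with hn_def
  have hn1 : 1 ≤ n := by omega
  have hnκ : 2 * M₂ < (n : ℝ) * κ := by
    have h1 : 2 * M₂ / κ < n := by refine lt_trans hn₀ ?_; rw [hn_def]; push_cast; linarith
    exact (div_lt_iff₀ hκpos).1 h1
  have hp0 : ∀ x : Site d, (x + e μ₀) μ₀ = x μ₀ + 1 := fun x => by rw [Pi.add_apply, he, if_pos rfl]
  have hcoord_p : ∀ (x : Site d) (ii : Fin d), ii ≠ μ₀ → (x + e μ₀) ii = x ii := fun x ii hii => by
    rw [Pi.add_apply, he, if_neg hii, add_zero]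
  have hQT : QT L i.k (i.Λs i.k) (1 : Site d → Fin d → 𝔸ˣ) μ (an n) =
      QT L i.k (i.Λs i.k) (1 : Site d → Fin d → 𝔸ˣ) μ (an n + e μ₀) := by
    refine QT_flat_lamTop_eq_of_blockMap hk (fun j => hΛ i.k j) μ fun j hj => ?_
    have hM : 2 ≤ L ^ j := le_trans hL (Nat.le_self_pow (by omega) L)
    funext ii
    rw [B7BlockGeometry.blockMap_apply, B7BlockGeometry.blockMap_apply]
    by_cases hii : ii = μ₀
    · rw [hii, hp0, han, if_neg h01, zero_add, Int.zero_ediv]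
      exact (Int.ediv_eq_zero_of_lt (by norm_num) (by exact_mod_cast hM)).symm
    · rw [hcoord_p _ ii hii]
  set F : Site d → 𝔸 := covLap i.η (1 : Site d → Fin d → 𝔸ˣ) f with hF
  have hFx : ∀ x, F x = G (G g) x • (1 : 𝔸) := fun x => by
    rw [hF, show f = fun y => G g y • (1 : 𝔸) from funext hfG, covLap_flat_realSmul_one, hG (G g)]
  have hdiff : D (an n) - D (an n + e μ₀) = F (an n) - F (an n + e μ₀) := by
    have h0 := hE (an n)
    have h1 := hE (an n + e μ₀)
    rw [covLap_flat_sub] at h0 h1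
    have : (D (an n) - F (an n)) - (D (an n + e μ₀) - F (an n + e μ₀)) = 0 := by
      show (covLap i.η 1 (covDivB i.η 1 (logCfg i.η W)) (an n) - covLap i.η 1 f (an n)) -
          (covLap i.η 1 (covDivB i.η 1 (logCfg i.η W)) (an n + e μ₀) - covLap i.η 1 f (an n + e μ₀)) = 0
      rw [h0, h1, hQT, sub_self]
    rw [← sub_eq_zero]
    rw [← this]
    abel
  have hFκ : F (an n) - F (an n + e μ₀) = ((n : ℝ) * κ) • (1 : 𝔸) := by
    rw [hFx, hFx, ← sub_smul]
    congr 1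
    have h1 := train_flatLap_flatLap_at h10 hG hg han hcx hn1 (x := 0) (Or.inl rfl)
    have h2 := train_flatLap_flatLap_at h10 hG hg han hcx hn1 (x := e μ₀) (Or.inr rfl)
    rw [add_zero] at h1
    rw [h1, h2, hκ]
    ring
  have hnorm : (n : ℝ) * κ ≤ 2 * M₂ := by
    have h1 : ‖F (an n) - F (an n + e μ₀)‖ = (n : ℝ) * κ := by
      rw [hFκ, norm_smul, norm_one, mul_one, Real.norm_eq_abs, abs_of_pos (by positivity)]
    rw [← h1, ← hdiff]
    calc ‖D (an n) - D (an n + e μ₀)‖ ≤ ‖D (an n)‖ + ‖D (an n + e μ₀)‖ := norm_sub_le _ _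
      _ ≤ M₂ + M₂ := add_le_add (hDb _) (hDb _)
      _ = 2 * M₂ := by ring
  linarith

end Unbounded

/-! ## §4 At the four-law sub-family of record -/

section Record

open Node00 (Stage3Params IdxB8)
open B8IdxB8LawsB (IdxB8SubB famB8OfRecordSubB idxB8LawsB_of_member_univ)

/-- ★ **At NODE 00's four-law sub-family of record `B8IdxB8LawsB.famB8OfRecordSubB θ β len`** (`θ.D ≥ 2`; the depth-one all-`ℤᵈ` member at
`η = L⁻¹`, a law member by `idxB8LawsB_of_member_univ`): for every `γ > 0`, `B₁` and every threshold `c₁ > 0` the body of `Thm8SurvivingAt`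
fails at that member on a HERMITIAN (unbounded) source — so a Hermitian re-typing of the source space alone leaves `t8` false at the record;
the finite-norm clause is needed as well. [cite: Balaban1985RegularSpaces, Thm 8 (1.146) p.101, p.86 (definition after (1.55)), p.77] -/
theorem thm8Surviving_fails_hermitian_unbounded_source_famB8OfRecordSubB (θ : Stage3Params) (hD : 2 ≤ θ.D) (β : ℝ)
    (len : Site θ.D → ℝ) {γ : ℝ} (hγ : 0 < γ) (B₁ : ℝ) {c₁ : ℝ} (hc₁ : 0 < c₁) :
    ∃ (a : IdxB8SubB θ) (α₀ α₁ : ℝ) (U₀ : (famB8OfRecordSubB θ β len a).Cfg) (U' : (famB8OfRecordSubB θ β len a).Pert)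
      (f : Site θ.D → θ.𝔸),
      0 < α₀ ∧ 0 < α₁ ∧ α₀ + α₁ ≤ c₁ ∧ (∀ x, IsSelfAdjoint (f x)) ∧
      (famB8OfRecordSubB θ β len a).InA α₀ U₀ ∧ (famB8OfRecordSubB θ β len a).InAAx α₀ U₀ U' ∧
      (famB8OfRecordSubB θ β len a).avgClose α₁ U₀ U' ∧
      (famB8OfRecordSubB θ β len a).InR U₀ f ∧ (famB8OfRecordSubB θ β len a).fNorm f < γ * (α₀ + α₁) ∧
      ¬ ∃ u : (famB8OfRecordSubB θ β len a).GT,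
          (famB8OfRecordSubB θ β len a).C162 B₁ (α₀ + α₁) U₀ ((famB8OfRecordSubB θ β len a).act U' u) ∧
          (famB8OfRecordSubB θ β len a).LandauF U₀ f ((famB8OfRecordSubB θ β len a).act U' u) := by
  have hL : 2 ≤ θ.L := θ.two_le_L
  have hL1 : 1 ≤ θ.L := le_trans (by norm_num) hL
  have hη : (0 : ℝ) < ((θ.L : ℝ)⁻¹) ^ 1 := pow_pos (inv_pos.mpr (by exact_mod_cast (show 0 < θ.L by omega))) 1
  obtain ⟨i, h0, hik, hiη, hΩ, hΛ, hΛb⟩ := B8LeafModelZd3NonVacuity.exists_member_univ (d := θ.D) hL1 (k := 1) le_rfl hη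
  exact ⟨⟨⟨i, h0⟩, idxB8LawsB_of_member_univ hL1 (by rw [hiη, hik]) hΩ hΛ hΛb⟩,
    thm8Surviving_fails_hermitian_unbounded_source hD hL β len hγ B₁ i hΩ hΛ hik hc₁⟩

end Record

#print axioms thm8Surviving_fails_hermitian_unbounded_source

end Literature.MathematicalPhysics.QuantumFieldTheory.Balaban1983to89.B8LeafModelZd3SourceBounded

end
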